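import Summits.QuantumFields.BalabanUV.T4Continuum.Support.NE7SliceRepFibrePoincare
import Summits.QuantumFields.BalabanUV.T4Continuum.Support.NE7FrameFreeRightInverse
import Summits.QuantumFields.BalabanUV.T4Continuum.Support.NE3FrameFreeDecompositionW
import HarnessLib

/-!
# NE7SliceRepExists — EVERY FIBRE ELEMENT IS CORNER-TRIVIALLY GAUGE-EQUIVALENT TO A SLICE REPRESENTATIVE: for every skew periodic fine field `X` with `k`-fold linearised average
# `φ = D(avg^{k+1})_W[X]` there is a `𝔲(n)`-valued periodic gauge parameter `μ` VANISHING AT THE TOP CORNERS `L^{k+1}·ℤ^d` with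
# `(X + gaugeDir W μ) − R₀ φ ∈ frameFreeBlockLandauW L N (k+1) W` and `D(avg^{k+1})_W[X + gaugeDir W μ] = φ` — the fibre over `φ` meets the affine slice `R₀ φ + T_♮(W)` along the orbit
# of the fine stabiliser (general `d`, every `U(n)`, `L ≥ 2`, `L^d ≥ 2`; lineage `b2b-balaban-t4-ne7-p1`, gen 118, file G3; ROAD-G117 §4 (S1)(α))

Cell `pub-balaban`, rung (B)+1 sub-cell t4, CRUX PROVER NE7 #1 (OWNER of row NE7), generation 118.  Inputs BY NAME: row NE3's (E_W) ✓ `NE3FrameFreeDecompositionW.exists_cornerGauge_mem_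
frameFreeBlockLandauW` (every skew periodic TANGENT field is moved into `T_♮(W)` by the gauge direction of a corner-trivial generator), this lineage's frame-free right inverse
✓ `NE7FrameFreeRightInverse.rightInvW0` (`dirIter (k+1) W (R₀ φ) = φ`), row NE3's ✓ `NE3TangentCovariantTower.dirIter_gaugeDir` (corner-trivial gauge directions are tangent), and this
gen's G1 ✓ `NE7SliceRepFibrePoincare.tangentIter_sub_of_dirIter_eq`.
WHAT ([folklore]; 0 def, 0 sorry): `dirIter_add_gaugeDir_cornerTrivial` (corner-trivial gauge directions do not move the `k`-fold linearised average) and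
**`exists_cornerGauge_sliceRep`** (displayed above).  With row NE7b's ✓ `NE7BorderedHessianGaugeDegenerate.borderedForm_add_gaugeDir` (the bordered Hessian is blind to such
directions) this reduces the minimisation over the fibre to the slice, where G2 ✓ `NE7SliceRepHessianFloor` bounds the Hessian term from below (assembly: G4).
HONEST FRAMING: kinematics over landed kernel theorems about OUR objects; nothing of Bałaban's asserted ([Balaban1985Variational] (83) p.290 is CONTEXT); NOT (G′), NOT NE7 as a spine
node, NOT NE3; spine 0∕9; finite T⁴ rung (B)+1 — NOT infinite volume, NOT mass gap, NOT BetaPertH, NOT Clay.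
-/

set_option autoImplicit false

open scoped BigOperators Matrix.Norms.L2Operator
open Finset

namespace Summit.QuantumFields.BalabanUV.T4Continuum.NE7SliceRepExists

open Literature.MathematicalPhysics.QuantumFieldTheory.Balaban1983to89
open B7Prop1Explicit B7Prop2Explicit
open T4AveragingDeficitWall (IsUnitaryCfg IsSkewDir SmallField Ad)
open T4AveragingDeficitWallBoundary (IsPeriodicCfg)
open AveragingDeficitPeriodicCounting (IsPeriodicDir)
open AveragingDeficitNearIdentity (Ad_zero)
open AveragingDeficitTwoLevelPrep (prop1Radius)
open AveragingDeficitMultiLevelPrep (cavgIter tower LevelSmall TangentIter)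
open BlockAveragePushDirGauge (gaugeDir isPeriodicDir_gaugeDir)
open NE3TangentCovariantTower (framePotW dirIter dirIter_add dirIter_gaugeDir)
open NE3LandauOrbit (gaugeDir_skew)
open NE3QbarIterCovLiftPrep (cruxC)
open NE3FrameFreeSliceW (frameFreeBlockLandauW)
open NE3FrameFreeDecompositionW (exists_cornerGauge_mem_frameFreeBlockLandauW)
open NE7FrameFreeRightInverse (rightInvW0 dirIter_rightInvW0 isSkewDir_rightInvW0 isPeriodicDir_rightInvW0)
open NE7SliceRepFibrePoincare (tangentIter_sub_of_dirIter_eq)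
open SpreadLift (loopRad)

noncomputable section

variable {d : ℕ} {n : Type*} [Fintype n] [DecidableEq n] [Nonempty n]

/-- **CORNER-TRIVIAL GAUGE DIRECTIONS DO NOT MOVE THE k-FOLD LINEARISED AVERAGE** (multi-level small-field class at `W`, period `tower L N (k+1)`; `μ` skew, periodic,
`μ(L^{k+1}·w) = 0`): `dirIter L (k+1) W (X + gaugeDir W μ) = dirIter L (k+1) W X`. [cite: Balaban1985Averaging, (45) p.24] -/
theorem dirIter_add_gaugeDir_cornerTrivial {L N : ℕ} [NeZero N] (hL : 1 ≤ L) (k : ℕ)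
    {W : Site d → Fin d → (Matrix n n ℂ)ˣ} {x : ℝ} (hWu : IsUnitaryCfg W) (hWP : IsPeriodicCfg W ((tower L N (k + 1) : ℕ) : ℤ))
    (hx : 0 ≤ x) (hs : LevelSmall d L k x) (hWx : SmallField W x) (X : Site d → Fin d → Matrix n n ℂ)
    {mu : Site d → Matrix n n ℂ} (hmus : ∀ y, mu y ∈ skewAdjoint (Matrix n n ℂ))
    (hmuP : ∀ (y : Site d) (i : Fin d), mu (y + ((tower L N (k + 1) : ℕ) : ℤ) • e i) = mu y) (hmu0 : ∀ w : Site d, mu (((L : ℤ) ^ (k + 1)) • w) = 0) :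
    dirIter L (k + 1) W (fun y ν => X y ν + gaugeDir W mu y ν) = dirIter L (k + 1) W X := by
  rw [dirIter_add hL k hWu hx hs hWx, dirIter_gaugeDir (M := N) hL k hWu hWP hx hs hWx hmus hmuP]
  funext z κ
  simp only [gaugeDir, hmu0, Ad_zero, sub_zero, add_zero]

/-- **EVERY FIBRE ELEMENT IS CORNER-TRIVIALLY GAUGE-EQUIVALENT TO A SLICE REPRESENTATIVE** (`L ≥ 2`, `L^d ≥ 2`, `d ≥ 1`; multi-level small-field class at `W` of period
`tower L N (k+1)` with the two parameter lines of `R₀`): for every skew `(tower)`-periodic `X` with `dirIter L (k+1) W X = φ` (`φ` skew, `N`-periodic) there is a skew periodic `μ` with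
`μ(L^{k+1}·w) = 0`, `dirIter L (k+1) W (X + gaugeDir W μ) = φ` and `(X + gaugeDir W μ) − R₀ φ ∈ frameFreeBlockLandauW L N (k+1) W`. [cite: Balaban1985Variational, (83) p.290] -/
theorem exists_cornerGauge_sliceRep {L N : ℕ} [NeZero N] (hL : 2 ≤ L) (hLd : 2 ≤ L ^ d) (hd : 1 ≤ d) (k : ℕ)
    {W : Site d → Fin d → (Matrix n n ℂ)ˣ} {x : ℝ} (hWu : IsUnitaryCfg W) (hWP : IsPeriodicCfg W ((tower L N (k + 1) : ℕ) : ℤ))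
    (hx : 0 ≤ x) (hs : LevelSmall d L k x) (hWx : SmallField W x)
    (hθ : cruxC d L * (((L : ℝ) ^ (k + 1)) ^ 2 * x) < 1)
    (hE : 4 * (d : ℝ) ^ 2 * ((L : ℝ) ^ (k + 1) - 1) ^ 2 * x + 16 * d * loopRad d L ((prop1Radius d L)^[k] x) ≤ 1 / 2)
    {X : Site d → Fin d → Matrix n n ℂ} (hXs : IsSkewDir X) (hXP : IsPeriodicDir X ((tower L N (k + 1) : ℕ) : ℤ))
    {φ : Site d → Fin d → Matrix n n ℂ} (hφ : IsSkewDir φ) (hφP : IsPeriodicDir φ (N : ℤ)) (hXφ : dirIter L (k + 1) W X = φ) :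
    ∃ mu : Site d → Matrix n n ℂ, (∀ y, mu y ∈ skewAdjoint (Matrix n n ℂ))
      ∧ (∀ (y : Site d) (i : Fin d), mu (y + ((tower L N (k + 1) : ℕ) : ℤ) • e i) = mu y)
      ∧ (∀ w : Site d, mu (((L : ℤ) ^ (k + 1)) • w) = 0)
      ∧ dirIter L (k + 1) W (fun y ν => X y ν + gaugeDir W mu y ν) = φ
      ∧ (fun y ν => (X y ν + gaugeDir W mu y ν) - rightInvW0 hL k hWu hx hs hWx N hθ hE hφ y ν)
          ∈ frameFreeBlockLandauW (d := d) (n := n) L N (k + 1) W := by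
  have hL1 : 1 ≤ L := by omega
  -- the lift and the tangent part
  have hR : dirIter L (k + 1) W (rightInvW0 hL k hWu hx hs hWx N hθ hE hφ) = φ := dirIter_rightInvW0 hL k hWu hx hs hWx N hθ hE hφ hWP hφP ⟨0, by omega⟩
  have hRs := isSkewDir_rightInvW0 hL k hWu hx hs hWx N hθ hE hφ
  have hRP := isPeriodicDir_rightInvW0 hL k hWu hx hs hWx N hθ hE hφ hWP
  have hY₀s : IsSkewDir (fun y ν => X y ν - rightInvW0 hL k hWu hx hs hWx N hθ hE hφ y ν) := fun y ν =>
    (skewAdjoint _).sub_mem (hXs y ν) (hRs y ν)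
  have hY₀P : IsPeriodicDir (fun y ν => X y ν - rightInvW0 hL k hWu hx hs hWx N hθ hE hφ y ν) ((tower L N (k + 1) : ℕ) : ℤ) := by
    intro y i ν
    show X _ ν - _ = X y ν - _
    rw [hXP y i ν, hRP y i ν]
  have hY₀T : TangentIter L k W (fun y ν => X y ν - rightInvW0 hL k hWu hx hs hWx N hθ hE hφ y ν) :=
    tangentIter_sub_of_dirIter_eq hL1 k hWu hx hs hWx (hXφ.trans hR.symm)
  -- row NE3's (E_W)
  obtain ⟨mu, hmus, hmuP, hmu0, hmem⟩ := exists_cornerGauge_mem_frameFreeBlockLandauW (M := N) hL1 hLd k hWu hWP hx hs hWx hY₀s hY₀P hY₀T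
  refine ⟨mu, hmus, hmuP, hmu0, ?_, ?_⟩
  · rw [dirIter_add_gaugeDir_cornerTrivial hL1 k hWu hWP hx hs hWx X hmus hmuP hmu0, hXφ]
  · have e : (fun y ν => (X y ν + gaugeDir W mu y ν) - rightInvW0 hL k hWu hx hs hWx N hθ hE hφ y ν)
        = (fun y ν => (X y ν - rightInvW0 hL k hWu hx hs hWx N hθ hE hφ y ν) + gaugeDir W mu y ν) := by
      funext y ν; abel
    rw [e]; exact hmem

end

end Summit.QuantumFields.BalabanUV.T4Continuum.NE7SliceRepExists
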